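import Literature.MathematicalPhysics.QuantumFieldTheory.Balaban1983to89.Node00.BgConstraintOfRecord
import HarnessLib

/-!
# NODE N07 — [15] (20) AT THE RECORD: ON THE `SU(N)`-VALUED CHART `↑U = exp(iη_kA′)·U₀` THE CONSTRAINT «`Ū^k(U) = V`» ((3)∕(18)) IS THE LOG EQUATION
# «`Q_k(U₀)A′ + C_k(A′) = B(V)`» ((20) in the (44)-split form), FOR def-Y's PINNED LETTERS `QOfRecord`∕`COfRecord`∕`BOfRecord` (M2 files 3b, 3e′)

Cell `pub-ymgap`, width seat `pub-ymgap-dag-n07-w3` (g25), INTENT-5 ∕ CLAIM-5.  `--kind proof --supports stmt-QuantumFields-27238 --as helper`; count-neutral.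
[15] = [Balaban1985Variational]; [B8] = [Balaban1985RegularSpaces]; [I] = [Balaban1987RG1].

WHY.  def-Y's ✓`Node00/BgConstraintOfRecord.lean` (M2 file 3e′, ✓p819089) pins the record's nonlinear constraint letters — `BOfRecord` ((20) «B = (1/i) log(V·(Ū^kU₀)⁻¹)»),
`COfRecord` ((44) «C(A′) = (1/i) log(Ū^k_h(exp(iη_kA′)U₀)·(Ū^kU₀)⋆) − Q_k(U₀)A′», `Ū^k_h` = lit's holomorphic `iterMh`) — and lists among the tokens NOT asserted there
«the equality (20) `Q_k(U₀, ηA) = B` for the minimiser».  On the `SU(N)`-valued chart this is BOOKKEEPING: whenever a genuine configuration `U : bonds → SU(N)` has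
matrix `↑U = exp(iη_kA′)·U₀` (print's (15)∕(19); then `η_kA′(b)` is Hermitian-traceless up to the exponential's kernel — the only place the letters are print's) and
lies in the (0.4) small-field guard below `k`, the holomorphic average IS the genuine one (def-Y's `iterMh_coeField_of_smallBelow` at `U`), so
`Q_k(U₀)A′ + C(A′) = (1/i) log(Ū^k(U)·(Ū^kU₀)⋆) = B(Ū^k U)`; hence the constraint `Ū^k(U) = V` gives (20) `Q_k(U₀)A′ + C(A′) = B(V)`, and CONVERSELY on the log-disc
(`MatrixLog.exp_mlog`).  This is the identity by which the constraint (18)∕(3) enters Prop. 6's scheme at the record ((47)–(50), (100)–(101): `QA′ = B − D(A′)`).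

WHAT IS PROVED (sorry-free; no definition; axioms standard).
* §1 ★★ `Q_add_COfRecord_apply_eq_BOfRecord_iter` — for `A′ : Space115Lit …`, `U` with `coeField U = expOver U₀ (η_k • evLit … A′)` and `SmallBelow (avOfRecord F N K) k U`:
  `Q_k(U₀)A′(c) + C(A′)(c) = B(Ū^kU)(c)` at every level-`k` bond; ★★★ `Q_add_COfRecord_apply_eq_BOfRecord_of_iter_eq` — **(20) AT THE RECORD**: if moreover `Ū^k(U) = V` then
  `Q_k(U₀)A′(c) + C(A′)(c) = B(V)(c)`; function-level forms `Q_add_COfRecord_eq_BOfRecord_iter` ∕ `…_of_iter_eq`.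
* §2 ★★ `iter_eq_of_Q_add_COfRecord_eq_BOfRecord` — THE CONVERSE on the log-disc: if `Q_k(U₀)A′ + C(A′) = B(V)` bondwise and both `Ū^k(U)(c)·(Ū^kU₀)(c)⋆` and
  `V(c)·(Ū^kU₀)(c)⋆` lie in `‖· − 1‖ < 1`, then `Ū^k(U) = V`; ★★★ `iter_eq_iff_Q_add_COfRecord_eq_BOfRecord` — «(18) ⟺ (20)» on the disc.
* §3 E1 at the unit data: `Q_add_COfRecord_one_zero` (at `U₀ = U = 1`, `A′ = 0`, `V = 1` both sides are `0`).

HONEST SCOPE.  Bookkeeping over def-Y's letters (unfolding + `iterMh = ↑Ū^k` on guarded `SU(N)` fields + `exp ∘ log = id` on the disc); the chart hypothesis `↑U = exp(iη_kA′)U₀`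
is DISPLAYED (it is where the letters are print's: `SU(N)`-valued charts, cf. this seat's located rider on the trace line, bus 2026-08-31T09:48Z); nothing of (19)'s radii, of the
existence of the gauge `u` of [B8] Thm 2, of (44)'s estimate or of [15] Thm 1 is asserted; P0 ⟨26900⟩ OPEN; K0ᴬ∕K1ᴬ∕K3ᴬ OPEN; N07 NOT discharged; COUNT 8∕28 · K 1∕4 UNMOVED;
finite `𝕋⁴` at fixed `ε` — R4 closes only the conditional finite-𝕋⁴ rung `BalabanLadder.UV`, never the summit; nothing continuum ∕ ℝ⁴ ∕ OS; the Yang–Mills mass gap (Clay) is NOT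
proved by any of this.  No `sorry`, no `def`, no `instance`, no `notation`.

References: [15] (3) p. 278, (15) p. 280, (18)–(20) p. 281, (44) p. 285, (47)–(50) p. 285, (100)–(101) p. 293; [B8] (1.31) p. 82; [I] (0.4) p. 253.
-/

set_option autoImplicit false

noncomputable section

open scoped Matrix Matrix.Norms.L2Operator InnerProductSpace ComplexConjugate

namespace Summit.QuantumFields.YangMills.Theorems.N07ConstraintEq20OfRecord

open Literature.MathematicalPhysics.QuantumFieldTheory.Balaban1983to89
open Literature.MathematicalPhysics.QuantumFieldTheory.Balaban1983to89.T4Continuum (T4Family)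
open T4Continuum BlockAveraging
open NormedSpace (exp)
open MatrixLog (mlog mlog_one exp_mlog)
open B15AveragingHolomorphic (iterMh)
open B11Eq115Space (NegSize NegSup levWeight)
open Node00

variable (F : T4Family) (N : ℕ) [NeZero N] {K : ℕ} (k : ℕ) (Ω : ℕ → Set (Site (F.P K) 0)) (U₀ : GaugeField (F.P K) 0 (SU N))
  (levB : PBond (F.P K) k → ℕ)

/-! ## §1  On the `SU(N)`-valued chart: `Q_k(U₀)A′ + C(A′) = B(Ū^k U)`, hence (20) -/

/-- ★★ **`Q_k(U₀)A′(c) + C(A′)(c) = B(Ū^kU)(c)`** for every `A′` charting a genuine configuration `U` (`↑U = exp(iη_kA′)·U₀`) in the (0.4) guard below `k`: there the holomorphic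
average of the chart IS `↑Ū^k(U)` (def-Y's `iterMh_coeField_of_smallBelow`), and `C = (1/i) log(Ū^k(U)(Ū^kU₀)⋆) − Q_k(U₀)A′` by definition.
[cite: Balaban1985Variational, (20) p.281, (44) p.285; Balaban1987RG1, (0.4) p.253] -/
theorem Q_add_COfRecord_apply_eq_BOfRecord_iter (A : Space115Lit F N K k Ω U₀) {U : GaugeField (F.P K) 0 (SU N)}
    (hU : coeField U = expOver U₀ ((((F.P K).eta k : ℝ) : ℂ) • evLit F N K k Ω U₀ A)) (hUg : SmallBelow (avOfRecord F N K) k U) (c : PBond (F.P K) k) :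
    qCplxOp k U₀ (evLit F N K k Ω U₀ A) c + NegSup.equiv _ _ (COfRecord F N K k Ω U₀ levB A) c
      = NegSup.equiv _ _ (BOfRecord F N K k U₀ levB (Averaging.iter (avOfRecord F N K) k U)) c := by
  rw [COfRecord_apply, BOfRecord_apply, ← hU, iterMh_coeField_of_smallBelow F N k U hUg, coeField_apply, add_sub_cancel]

/-- ★★★ **(20) AT THE RECORD — «`Q_k(U₀, ηA) = B`» in the (44)-split form**: if the chart `↑U = exp(iη_kA′)U₀` of `A′` is a guarded configuration with `Ū^k(U) = V` (the constraint
(3)∕(18)), then `Q_k(U₀)A′(c) + C(A′)(c) = B(V)(c)` at every level-`k` bond. [cite: Balaban1985Variational, (18)–(20) p.281, (44) p.285, (100)–(101) p.293] -/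
theorem Q_add_COfRecord_apply_eq_BOfRecord_of_iter_eq (A : Space115Lit F N K k Ω U₀) {U : GaugeField (F.P K) 0 (SU N)} {V : GaugeField (F.P K) k (SU N)}
    (hU : coeField U = expOver U₀ ((((F.P K).eta k : ℝ) : ℂ) • evLit F N K k Ω U₀ A)) (hUg : SmallBelow (avOfRecord F N K) k U)
    (hV : Averaging.iter (avOfRecord F N K) k U = V) (c : PBond (F.P K) k) :
    qCplxOp k U₀ (evLit F N K k Ω U₀ A) c + NegSup.equiv _ _ (COfRecord F N K k Ω U₀ levB A) c = NegSup.equiv _ _ (BOfRecord F N K k U₀ levB V) c := by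
  rw [Q_add_COfRecord_apply_eq_BOfRecord_iter F N k Ω U₀ levB A hU hUg, hV]

/-- Function-level form of §1's identity: `Q_k(U₀)A′ + C(A′) = B(Ū^kU)` as level-`k` matrix fields. [cite: Balaban1985Variational, (20) p.281, (44) p.285] -/
theorem Q_add_COfRecord_eq_BOfRecord_iter (A : Space115Lit F N K k Ω U₀) {U : GaugeField (F.P K) 0 (SU N)}
    (hU : coeField U = expOver U₀ ((((F.P K).eta k : ℝ) : ℂ) • evLit F N K k Ω U₀ A)) (hUg : SmallBelow (avOfRecord F N K) k U) :
    qCplxOp k U₀ (evLit F N K k Ω U₀ A) + NegSup.equiv _ _ (COfRecord F N K k Ω U₀ levB A)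
      = NegSup.equiv _ _ (BOfRecord F N K k U₀ levB (Averaging.iter (avOfRecord F N K) k U)) :=
  funext fun c => Q_add_COfRecord_apply_eq_BOfRecord_iter F N k Ω U₀ levB A hU hUg c

/-- Function-level (20): `Ū^k(U) = V ⟹ Q_k(U₀)A′ + C(A′) = B(V)`. [cite: Balaban1985Variational, (18)–(20) p.281] -/
theorem Q_add_COfRecord_eq_BOfRecord_of_iter_eq (A : Space115Lit F N K k Ω U₀) {U : GaugeField (F.P K) 0 (SU N)} {V : GaugeField (F.P K) k (SU N)}
    (hU : coeField U = expOver U₀ ((((F.P K).eta k : ℝ) : ℂ) • evLit F N K k Ω U₀ A)) (hUg : SmallBelow (avOfRecord F N K) k U)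
    (hV : Averaging.iter (avOfRecord F N K) k U = V) :
    qCplxOp k U₀ (evLit F N K k Ω U₀ A) + NegSup.equiv _ _ (COfRecord F N K k Ω U₀ levB A) = NegSup.equiv _ _ (BOfRecord F N K k U₀ levB V) := by
  rw [Q_add_COfRecord_eq_BOfRecord_iter F N k Ω U₀ levB A hU hUg, hV]

/-! ## §2  The converse on the log-disc: (20) ⟹ (18) -/

omit [NeZero N] in
/-- Right multiplication by a unitary `SU(N)` value is injective: `X·W⋆ = Y·W⋆ → X = Y`. [cite: Balaban1985Variational, (20) p.281 (bookkeeping)] -/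
theorem eq_of_mul_star_coe_eq (W : SU N) {X Y : Matrix (Fin N) (Fin N) ℂ}
    (h : X * star (W : Matrix (Fin N) (Fin N) ℂ) = Y * star (W : Matrix (Fin N) (Fin N) ℂ)) : X = Y := by
  have h' := congrArg (fun Z => Z * (W : Matrix (Fin N) (Fin N) ℂ)) h
  simpa only [mul_assoc, star_coe_mul_coe_SU, mul_one] using h'

/-- ★★ **(20) ⟹ (18) ON THE LOG-DISC**: if `Q_k(U₀)A′ + C(A′) = B(V)` bondwise for the `SU(N)`-valued guarded chart `U` of `A′`, and both relative averages `Ū^k(U)(c)(Ū^kU₀)(c)⋆`,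
`V(c)(Ū^kU₀)(c)⋆` lie in the disc `‖· − 1‖ < 1` where `exp ∘ log = id` (`MatrixLog.exp_mlog`), then `Ū^k(U) = V`. [cite: Balaban1985Variational, (18)–(20) p.281; Balaban1985Averaging, (21) p.21] -/
theorem iter_eq_of_Q_add_COfRecord_eq_BOfRecord (A : Space115Lit F N K k Ω U₀) {U : GaugeField (F.P K) 0 (SU N)} {V : GaugeField (F.P K) k (SU N)}
    (hU : coeField U = expOver U₀ ((((F.P K).eta k : ℝ) : ℂ) • evLit F N K k Ω U₀ A)) (hUg : SmallBelow (avOfRecord F N K) k U)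
    (hdiscU : ∀ c : PBond (F.P K) k, ‖(Averaging.iter (avOfRecord F N K) k U c : Matrix (Fin N) (Fin N) ℂ) *
      star (Averaging.iter (avOfRecord F N K) k U₀ c : Matrix (Fin N) (Fin N) ℂ) - 1‖ < 1)
    (hdiscV : ∀ c : PBond (F.P K) k, ‖(V c : Matrix (Fin N) (Fin N) ℂ) * star (Averaging.iter (avOfRecord F N K) k U₀ c : Matrix (Fin N) (Fin N) ℂ) - 1‖ < 1)
    (h20 : ∀ c : PBond (F.P K) k, qCplxOp k U₀ (evLit F N K k Ω U₀ A) c + NegSup.equiv _ _ (COfRecord F N K k Ω U₀ levB A) c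
      = NegSup.equiv _ _ (BOfRecord F N K k U₀ levB V) c) :
    Averaging.iter (avOfRecord F N K) k U = V := by
  funext c
  have h := h20 c
  rw [Q_add_COfRecord_apply_eq_BOfRecord_iter F N k Ω U₀ levB A hU hUg c, BOfRecord_apply, BOfRecord_apply] at h
  have hlog := smul_right_injective (Matrix (Fin N) (Fin N) ℂ) (inv_ne_zero Complex.I_ne_zero) h
  have hexp := congrArg exp hlog
  rw [exp_mlog (hdiscU c), exp_mlog (hdiscV c)] at hexp
  exact Subtype.ext (eq_of_mul_star_coe_eq N _ hexp)

/-- ★★★ **«(18) ⟺ (20)» ON THE DISC**: for the `SU(N)`-valued guarded chart `U` of `A′`, with both relative averages in the log-disc, `Ū^k(U) = V` IFF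
`Q_k(U₀)A′ + C(A′) = B(V)` bondwise. [cite: Balaban1985Variational, (18)–(20) p.281, (44) p.285] -/
theorem iter_eq_iff_Q_add_COfRecord_eq_BOfRecord (A : Space115Lit F N K k Ω U₀) {U : GaugeField (F.P K) 0 (SU N)} {V : GaugeField (F.P K) k (SU N)}
    (hU : coeField U = expOver U₀ ((((F.P K).eta k : ℝ) : ℂ) • evLit F N K k Ω U₀ A)) (hUg : SmallBelow (avOfRecord F N K) k U)
    (hdiscU : ∀ c : PBond (F.P K) k, ‖(Averaging.iter (avOfRecord F N K) k U c : Matrix (Fin N) (Fin N) ℂ) *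
      star (Averaging.iter (avOfRecord F N K) k U₀ c : Matrix (Fin N) (Fin N) ℂ) - 1‖ < 1)
    (hdiscV : ∀ c : PBond (F.P K) k, ‖(V c : Matrix (Fin N) (Fin N) ℂ) * star (Averaging.iter (avOfRecord F N K) k U₀ c : Matrix (Fin N) (Fin N) ℂ) - 1‖ < 1) :
    Averaging.iter (avOfRecord F N K) k U = V ↔
      ∀ c : PBond (F.P K) k, qCplxOp k U₀ (evLit F N K k Ω U₀ A) c + NegSup.equiv _ _ (COfRecord F N K k Ω U₀ levB A) c
        = NegSup.equiv _ _ (BOfRecord F N K k U₀ levB V) c :=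
  ⟨fun hV c => Q_add_COfRecord_apply_eq_BOfRecord_of_iter_eq F N k Ω U₀ levB A hU hUg hV c,
    fun h20 => iter_eq_of_Q_add_COfRecord_eq_BOfRecord F N k Ω U₀ levB A hU hUg hdiscU hdiscV h20⟩

/-! ## §3  E1 at the unit data -/

/-- **E1: at `U₀ = U = 1`, `A′ = 0`, `V = 1` both sides of (20) vanish** (`Q_k(1)0 = 0`, `C(0) = 0`, `B(1) = 0` — def-Y's `COfRecord_one_zero`, `BOfRecord_one_one`).
[cite: Balaban1985Variational, (20) p.281, (3) p.278] -/
theorem Q_add_COfRecord_one_zero :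
    qCplxOp k (1 : GaugeField (F.P K) 0 (SU N)) (evLit F N K k Ω (1 : GaugeField (F.P K) 0 (SU N)) 0) +
        NegSup.equiv _ _ (COfRecord F N K k Ω (1 : GaugeField (F.P K) 0 (SU N)) levB 0)
      = NegSup.equiv _ _ (BOfRecord F N K k (1 : GaugeField (F.P K) 0 (SU N)) levB 1) := by
  rw [COfRecord_one_zero, BOfRecord_one_one, map_zero, map_zero, zero_add]

end Summit.QuantumFields.YangMills.Theorems.N07ConstraintEq20OfRecord
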